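import Summits.ABC.IUTFork.Conditional.AbcOfSGenuineMOrbit
import Summits.ABC.IUTFork.Cor312PilotIdelesMNumbers
import HarnessLib

/-!
# Branch C certificate v9 (INTAKE fold «v8M-SHRINK»): the HULL-LEVEL line at the summand-route M-LEVEL GENUINE REAL SETTING of every datum
# with the q-PIN discharged BY CONSTRUCTION and the PROVENANCE link discharged BY NAME — per datum S_H 1 · ORBIT 1 (`hA`), apex `abc_of_SH_v9M`

C scoreboard, v9 companion of v8 (`abc_of_SH_v8M`, abc-iut-C-cert-3 p440003 ✓ / per datum `GenuineMOrbit.cor312Of_of_SH` p439769 ✓, which read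
per datum S_H 1 · PIN 1 · PROV 1 · ORBIT 1 + CONE 1 = 5): here per datum S_H 1 · ORBIT 1 (`hA`) · PIN 0 · PROV 0 · BRIDGE 0 · READ 0 · SIDE 0 · FACT 0
= 2 (explicit), plus the (P,l)-level CONE binder `hreg` = **3 explicit at the apex** (`hSH` · `hA` · `hreg`); EFFECTIVE: tool line on STATUS. This is
the successor task the INTAKE seat abc-iut-C-cert-3 named on closing (STATUS 2026-08-26T11:14:04Z «file `Conditional/AbcOfSGenuineMShrink1.lean`
instantiating [PROV] / [ORBIT] BY NAME»), executed by abc-iut-s2-p12 (gen 4). WHAT MOVED (by name / by construction, all LANDED inputs; nothing re-typed):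
* [PIN] `hQPin : Cor312Vol.QPinned S P ρ qK` (:= `∀ j v_ℚ, P.qRegion j v_ℚ = ρ qK j v_ℚ`, abc-iut-w5-d230 `Cor312PinnedRegions` l. 91) is DISCHARGED
  BY CONSTRUCTION: the region-forming operator is PINNED to the setting's own q-region, `ρ := fun _ => P.qRegion`, and the q-pin is `fun _ _ => rfl`
  — exactly abc-iut-C-cert-1's v6K reduction (p437297, `AbcOfSGenuineKChosen`) and abc-iut-s2-p10's v5K one (p437376), now at the M setting (the
  «one-liner OWED at the M setting» of abc-iut-s2-ref's board 10:47Z / 11:00Z); `qK` stays a FREE data binder and [S_H] is read at the pinned `ρ`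
  (the content of the q-pin moves into `hSH`, as on every K-level line since v5K_qPin);
* [PROV] `hprov : Cor312Prov.IsSettingOf T.D P` (abc-iut-c312-8's provenance link = the q-number `P.negLogQ = −(1/2l)·log(q)`) is DISCHARGED BY
  NAME: abc-iut-w5-d244's `isSettingOf_settingMSharp_tqM` (p439939 ✓, G1-Θ P5-numbers, at the frames-route sharp setting with the GENUINE
  q-ideles `tqM` of the datum's idele data) transported to abc-iut-s2-p8's summand-route `settingPrVolSharpM` (p438078 ✓; `= settingPrVolM` at the
  sharp binders, definitionally) by abc-iut-w4-d013's two-routes identity `isSettingOf_settingMSharp_iff` (p437121 ✓) — the composite is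
  abc-iut-w5-d244's announced `isSettingOf_settingPrVolSharpM_tqM` (p440575; consumed here through its two landed factors so that this file
  depends on BUILT modules only);
* [S_H] `hSH` and [ORBIT] `hA` are now demanded at ADMISSIBLE `(P, l)` only (`P ∈ UP`, `l` prime, `5 ≤ l`, `AdmitsCore`, `CondP2/5/6`) — the guards
  abc-iut-c312-8's capstone `ThetaPartII.ABC_of_cor312_of_hullRegime` (p428563) supplies; a WEAKENING of v8's unguarded demand (C-R2), verbatim
  the guard shape of v6K.
What is LEFT per datum: [S_H] `hSH` (the adjudication object, not a target) and [ORBIT] `hA` — abc-iut-w5-d166's per-packet orbit-hull bound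
(p438889's hypothesis VERBATIM at `r := ideleDataOf T.D T.isVolumeInputOf`; G1-Θ (U1)-HULL instA/instB/instC, abc-iut-s2-p7 p437184 ✓ / p439554,
abc-iut-s2-p8) — plus the (P,l)-level CONE `hreg` (TARGET #1 residue). When G1-Θ lands `hA` as a theorem (instA ∘ instB ∘ instC), v10 (2 explicit: `hSH` · `hreg`) is ONE `exact` away from
`GenuineMShrink.cor312Of_of_SH`.

PROOF-ONLY file (no `def`, no new `Prop`, no instance, no notation). THE SETTING per datum is v8's VERBATIM: abc-iut-s2-p8's
`Real.settingPrVolSharpM T.D (logvAnalyticVal_analyticLogvVal (K := T.K)) (tOfIdeleData T.D (ideleDataOf T.D T.isVolumeInputOf)) (tqM …) …`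
(Θ- and q-ideles READ OFF the datum's own input, abc-iut-w5-d033 p436273; `Sq = Sθ := (GenuineM.finite_ratPlaces_under_S T.D).toFinset`), situation
`LatticeSituation.ofShells (logShellsOfInitialDH T.D (analyticLogvVal T.K)) … (summandPiecesPrM …).Adm (summandPiecesPrM …).logvol …`; `hA` is stated,
as in p438889 / v8, at the FRAMES-route local Θ-volume `(settingMSharp …).thetaLocal` (= the summand-route one, abc-iut-s2-p8
`thetaLocal_settingMSharp_eq_settingPrVolSharpM`).

HONEST FRAMING: this campaign LOCATES / CONDITIONALLY VERIFIES. Nothing here asserts that abc is proved or refuted, or that [IUTchIII]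
Cor. 3.12 / Thm. 3.11 holds or fails, or takes a side on any author (Mochizuki / Scholze–Stix / Joshi / Dupuy–Hilado); «`ABC` follows from
S_H + the listed hypotheses AS TYPED, at these data», nothing more; S_H is an assumption label; typed ≠ proved; instantiated ≠ endorsed.
[claim: Mochizuki2012, status: disputed] [cite: Mochizuki2012, IUTchI Def. 3.1 (e) p. 62; IUTchIII Cor. 3.12 p. 173–174 (the q-pin (pq′) p. 174
l. 4–10), Step (xi-d) p. 183; IUTchIV Thm. 1.10 Steps (v)–(vi) p. 27–30, p. 23] [cite: DupuyHilado2025, §3.4, §3.9, Thm. 3.10.1, §4.10]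
-/

noncomputable section

open Set Function NumberField IsDedekindDomain

namespace Summit.ABC.IUTFork.Conditional

open Thm311 Thm311.Real Cor312 Cor312Vol Cor312Prov Literature.IUT.LogThetaLattice Literature.IUT.LogVolume
  Literature.IUT.HodgeTheaters Literature.IUT.LogVolume.ThetaData Literature.NumberTheory.NumberFields

section PerDatum

variable {F K Fbar : Type} [Field F] [NumberField F] [Field K] [NumberField K] [Algebra F K] [Field Fbar]
  [Algebra F Fbar] [Algebra K Fbar] {E : WeierstrassCurve F} [E.IsElliptic] {l : ℕ} {Pb : BadPlacePredicates K}

variable (D : InitialThetaData F K Fbar E l Pb) {I : ThetaVolumeInput (fieldOfModuli E) K}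
  (M : Type) [Field M] [NumberField M]
  (archPk : ∀ (j : (thetaIndexOfInitial D).Label) (vQ : (thetaIndexOfInitial D).VQ),
    Set ((logShellsOfInitialDH D (analyticLogvVal K)).Packet j vQ))
  (archSub : ∀ (j : (thetaIndexOfInitial D).Label) (v : (thetaIndexOfInitial D).V),
    Set ((logShellsOfInitialDH D (analyticLogvVal K)).Packet j ((thetaIndexOfInitial D).over v)))
  (Ψ : ℤ → ∀ v : (thetaIndexOfInitial D).V, v ∈ (thetaIndexOfInitial D).Vbad →
    Set ((logShellsOfInitialDH D (analyticLogvVal K)).StarPacket v))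
  (act : ℤ → ∀ v : (thetaIndexOfInitial D).V, v ∈ (thetaIndexOfInitial D).Vbad →
    (logShellsOfInitialDH D (analyticLogvVal K)).StarPacket v →
      Module.End ℚ ((logShellsOfInitialDH D (analyticLogvVal K)).StarPacket v))
  (Mmod : ℤ → ∀ j : (thetaIndexOfInitial D).LabelStar, Set ((logShellsOfInitialDH D (analyticLogvVal K)).GlobalPacket j.1))
  (region : ℤ → ∀ j : (thetaIndexOfInitial D).LabelStar, FinDivisor M → ∀ vQ : (thetaIndexOfInitial D).VQ,
    Set ((logShellsOfInitialDH D (analyticLogvVal K)).Packet j.1 vQ))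
  (frobAdm : ℤ → ℤ → ∀ (j : (thetaIndexOfInitial D).Label) (vQ : (thetaIndexOfInitial D).VQ),
    Set ((logShellsOfInitialDH D (analyticLogvVal K)).Packet j vQ) → Prop)
  (frobLogvol : ℤ → ℤ → ∀ (j : (thetaIndexOfInitial D).Label) (vQ : (thetaIndexOfInitial D).VQ),
    Set ((logShellsOfInitialDH D (analyticLogvVal K)).Packet j vQ) → ℝ)
  (frobΨ : ℤ → ℤ → ∀ v : (thetaIndexOfInitial D).V, v ∈ (thetaIndexOfInitial D).Vbad →
    Set ((logShellsOfInitialDH D (analyticLogvVal K)).StarPacket v))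
  (frobMmod : ℤ → ℤ → ∀ j : (thetaIndexOfInitial D).LabelStar, Set ((logShellsOfInitialDH D (analyticLogvVal K)).GlobalPacket j.1))
  (unitImage : ℤ → ℤ → ℕ → ∀ (j : (thetaIndexOfInitial D).Label) (vQ : (thetaIndexOfInitial D).VQ),
    Set ((logShellsOfInitialDH D (analyticLogvVal K)).Packet j vQ))
  (ballImage : ℤ → ℤ → ∀ (j : (thetaIndexOfInitial D).Label) (vQ : (thetaIndexOfInitial D).VQ),
    Set ((logShellsOfInitialDH D (analyticLogvVal K)).Packet j vQ))
  (thetaDiv : ℤ → ℤ → LgpDivisor M (thetaIndexOfInitial D).lstar)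
  (n : ℤ) {HT : Type} {LogLink : HT → HT → Type} {IsFull : ∀ {s t : HT}, LogLink s t → Prop}
  (lat : LGPGaussianLogThetaLattice LogLink IsFull)
  {Frd : Type} {IsoF : Frd → Frd → Type} {Ob : Frd → Type} {realify : Frd → Frd} {Strip : Type}
  {IsoS : Strip → Strip → Type} {Mv : ∀ v : (thetaIndexOfInitial D).V, v ∈ (thetaIndexOfInitial D).Vbad → Type}
  [∀ v h, Monoid (Mv v h)]
  (sig : GlobalLGPFrobenioidSignature (thetaIndexOfInitial D).lstar (thetaIndexOfInitial D).V
    (· ∈ (thetaIndexOfInitial D).Vbad) Frd IsoF Ob realify Strip IsoS Mv)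
  (split : SplittingMonoids Mv) {ObΔ : Type} {N : ∀ v : (thetaIndexOfInitial D).V, v ∈ (thetaIndexOfInitial D).Vbad → Type}
  [∀ v h, Monoid (N v h)] (qData : QPilotData ObΔ N)
  (qK : ∀ v : (thetaIndexOfInitial D).V, v ∈ (thetaIndexOfInitial D).Vbad →
    Set ((logShellsOfInitialDH D (analyticLogvVal K)).StarPacket v))


/-! ## §1. One datum at the summand-route M-level sharp setting of the datum's OWN ideles, q-region PINNED (`ρ := fun _ => P.qRegion`):
`I.Cor312Of` from S_H + the Θ-side bound — the q-pin by `rfl`, provenance / `BridgeHyps` / q-number by name -/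

/-- **[PROV] at the summand-route M-level sharp setting with the GENUINE q-ideles is a THEOREM** (abc-iut-c312-8's `Cor312Prov.IsSettingOf`):
abc-iut-w5-d244's frames-route `isSettingOf_settingMSharp_tqM` (p439939; q-number `−(1/2l)·log(q)` by `isSettingOf_ofInitial`) carried to
abc-iut-s2-p8's `settingPrVolSharpM` (= abc-iut-w4-d013's `settingPrVolM` at the sharp binders, by `rfl`) along abc-iut-w4-d013's two-routes
identity `isSettingOf_settingMSharp_iff` (p437121). The same statement, for generic Θ-ideles `t`, is abc-iut-w5-d244's
`Thm311.Real.isSettingOf_settingPrVolSharpM_tqM` (p440575); this by-name composite is recorded here at the datum's own Θ-ideles so that the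
certificate below imports BUILT modules only. [claim: Mochizuki2012, status: disputed] -/
theorem GenuineMShrink.isSettingOf_settingPrVolSharpM (hI : ThetaData.IsVolumeInputOf D I) :
    Cor312Prov.IsSettingOf D
      (settingPrVolSharpM D (logvAnalyticVal_analyticLogvVal (K := K)) (tOfIdeleData D (ideleDataOf D hI))
        (fun u x => tqM D (ratChar u) u (natCast_ratChar_mem u) (ideleDataOf D hI) x) M archPk archSub Ψ act Mmod region n lat sig split qData
        (fun u x => tqM_ne_zero D (ratChar u) u (natCast_ratChar_mem u) (ideleDataOf D hI) x)
        (GenuineM.finite_ratPlaces_under_S D).toFinset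
        (fun u x hu => norm_tqM_eq_one_of_not_mem D (ratChar u) u (natCast_ratChar_mem u) (ideleDataOf D hI) x
          fun hx => hu ((Set.Finite.mem_toFinset _).mpr ⟨x, hx⟩))) :=
  (isSettingOf_settingMSharp_iff D (logvAnalyticVal_analyticLogvVal (K := K)) M archPk archSub Ψ act Mmod region n lat sig split qData
      (tOfIdeleData D (ideleDataOf D hI)) (fun u x => tqM D (ratChar u) u (natCast_ratChar_mem u) (ideleDataOf D hI) x)
      (fun u x => tqM_ne_zero D (ratChar u) u (natCast_ratChar_mem u) (ideleDataOf D hI) x) (GenuineM.finite_ratPlaces_under_S D).toFinset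
      (fun u x hu => norm_tqM_eq_one_of_not_mem D (ratChar u) u (natCast_ratChar_mem u) (ideleDataOf D hI) x
        fun hx => hu ((Set.Finite.mem_toFinset _).mpr ⟨x, hx⟩))).mp
    (isSettingOf_settingMSharp_tqM D (logvAnalyticVal_analyticLogvVal (K := K)) M archPk archSub Ψ act Mmod region n lat sig split qData
      (tOfIdeleData D (ideleDataOf D hI)) (ideleDataOf D hI) (GenuineM.finite_ratPlaces_under_S D).toFinset
      (fun u x hu => norm_tqM_eq_one_of_not_mem D (ratChar u) u (natCast_ratChar_mem u) (ideleDataOf D hI) x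
        fun hx => hu ((Set.Finite.mem_toFinset _).mpr ⟨x, hx⟩)))

/-- **One datum, q-region PINNED, Θ-side MODULO the per-packet orbit-hull bound `hA`**: `I.Cor312Of` from [S_H] (read at
`ρ := fun _ => P.qRegion`) and [ORBIT] `hA` (abc-iut-w5-d166 p438889's hypothesis VERBATIM at `r := ideleDataOf D hI`) — explicit S_H 1 · ORBIT 1
· PIN 0 · PROV 0 · BRIDGE 0 · READ 0 · SIDE 0. Inside (abc-iut-C-cert-3's `GenuineMOrbit.cor312Of_of_SH`, p439769): `BridgeHyps`
(abc-iut-s2-p8 p438078), the printed `Statement` (abc-iut-w5-d068 `statement_of_pilotKummerCompatHull`), the Θ-side modulo `hA` (abc-iut-w5-d166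
`negLogTheta_settingPrVolSharpM_le_genuine_of_orbitHull` p438889 ∘ abc-iut-w5-d033 `negLogTheta_eq_ideleDataOf`); this theorem IS that one at `ρ := fun _ => P.qRegion`, `hQPin := fun _ _ => rfl`,
`hprov := GenuineMShrink.isSettingOf_settingPrVolSharpM …`. «`I.Cor312Of` follows from these hypotheses as typed, at these data» — no side
taken. [claim: Mochizuki2012, status: disputed] -/
theorem GenuineMShrink.cor312Of_of_SH (hI : ThetaData.IsVolumeInputOf D I)
    (hSH : Cor312Vol.PilotKummerCompatHull
      (LatticeSituation.ofShells (logShellsOfInitialDH D (analyticLogvVal K)) M archPk archSub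
        (summandPiecesPrM D (logvAnalyticVal_analyticLogvVal (K := K))).Adm (summandPiecesPrM D (logvAnalyticVal_analyticLogvVal (K := K))).logvol Ψ act Mmod region frobAdm frobLogvol
        frobΨ frobMmod unitImage ballImage thetaDiv)
      (settingPrVolSharpM D (logvAnalyticVal_analyticLogvVal (K := K)) (tOfIdeleData D (ideleDataOf D hI))
        (fun u x => tqM D (ratChar u) u (natCast_ratChar_mem u) (ideleDataOf D hI) x) M archPk archSub Ψ act Mmod region n lat sig split qData
        (fun u x => tqM_ne_zero D (ratChar u) u (natCast_ratChar_mem u) (ideleDataOf D hI) x)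
        (GenuineM.finite_ratPlaces_under_S D).toFinset
        (fun u x hu => norm_tqM_eq_one_of_not_mem D (ratChar u) u (natCast_ratChar_mem u) (ideleDataOf D hI) x
          fun hx => hu ((Set.Finite.mem_toFinset _).mpr ⟨x, hx⟩)))
      (fun _ => Cor312.Setting.qRegion
        (settingPrVolSharpM D (logvAnalyticVal_analyticLogvVal (K := K)) (tOfIdeleData D (ideleDataOf D hI))
        (fun u x => tqM D (ratChar u) u (natCast_ratChar_mem u) (ideleDataOf D hI) x) M archPk archSub Ψ act Mmod region n lat sig split qData
        (fun u x => tqM_ne_zero D (ratChar u) u (natCast_ratChar_mem u) (ideleDataOf D hI) x)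
        (GenuineM.finite_ratPlaces_under_S D).toFinset
        (fun u x hu => norm_tqM_eq_one_of_not_mem D (ratChar u) u (natCast_ratChar_mem u) (ideleDataOf D hI) x
          fun hx => hu ((Set.Finite.mem_toFinset _).mpr ⟨x, hx⟩)))) qK)
    (hA : ∀ (i : Fin (thetaIndexOfInitial D).lstar) (u : FinitePlace ℚ),
      (settingMSharp D (logvAnalyticVal_analyticLogvVal (K := K)) M archPk archSub Ψ act Mmod region n lat sig split qData (tOfIdeleData D (ideleDataOf D hI))
        (fun u x => tqM D (ratChar u) u (natCast_ratChar_mem u) (ideleDataOf D hI) x)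
        (fun u x => tqM_ne_zero D (ratChar u) u (natCast_ratChar_mem u) (ideleDataOf D hI) x)
        (GenuineM.finite_ratPlaces_under_S D).toFinset
        (fun u x hu => norm_tqM_eq_one_of_not_mem D (ratChar u) u (natCast_ratChar_mem u) (ideleDataOf D hI) x
          fun hx => hu ((Set.Finite.mem_toFinset _).mpr ⟨x, hx⟩))).thetaLocal (Setting.labelSucc i) (Val.non u) ≤
        ((orbitSumM D (ideleDataOf D hI) i u : ℝ) : WithTop ℝ)) :
    I.Cor312Of :=
  GenuineMOrbit.cor312Of_of_SH D M archPk archSub Ψ act Mmod region frobAdm frobLogvol frobΨ frobMmod unitImage ballImage thetaDiv n lat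
    sig split qData (fun _ => Cor312.Setting.qRegion
      (settingPrVolSharpM D (logvAnalyticVal_analyticLogvVal (K := K)) (tOfIdeleData D (ideleDataOf D hI))
      (fun u x => tqM D (ratChar u) u (natCast_ratChar_mem u) (ideleDataOf D hI) x) M archPk archSub Ψ act Mmod region n lat sig split qData
      (fun u x => tqM_ne_zero D (ratChar u) u (natCast_ratChar_mem u) (ideleDataOf D hI) x)
      (GenuineM.finite_ratPlaces_under_S D).toFinset
      (fun u x hu => norm_tqM_eq_one_of_not_mem D (ratChar u) u (natCast_ratChar_mem u) (ideleDataOf D hI) x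
        fun hx => hu ((Set.Finite.mem_toFinset _).mpr ⟨x, hx⟩)))) qK hI hSH (fun _ _ => rfl)
    (GenuineMShrink.isSettingOf_settingPrVolSharpM D M archPk archSub Ψ act Mmod region n lat sig split qData hI) hA

end PerDatum

/-! ## §2. The apex: `ABC` from S_H (pinned reading) + the orbit-hull bound per datum, and the hull-regime cone `hreg` -/

section Family

open Literature.NumberTheory.DiophantineGeometry.GenEll Summit.ABC.ABC.Theorems

/-- **`abc_of_SH_v9M` (branch C certificate v9 = v8 with the q-PIN and the PROVENANCE link discharged: HULL-LEVEL line AT THE SUMMAND-ROUTE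
M-LEVEL GENUINE REAL SETTING of each datum — carriers `K_{v̲}`, `v̲ ∈ V̲`, pilot regions read off the datum's OWN ideles, q-region PINNED; per datum
explicit S_H 1 · ORBIT 1 · PIN 0 · PROV 0 · BRIDGE 0 · READ 0 · SIDE 0 · FACT 0, plus the (P,l)-level CONE binder `hreg` = 3 explicit).** `ABC` from,
per `λ`-line point `P`, prime `l` and genuine Θ-volume datum `T`: DATA = the context binders of abc-iut-s2-p8's `settingPrVolSharpM T.D …` (logs
FIXED: analytic; free columns) and PR-1's uninterpreted q-datum `qK` — NO `ρ` (pinned to the setting's q-region), NO pilot-data / provenance-data /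
field / idele binder; HYPOTHESES = [S_H] `hSH` (at the pinned reading, ADMISSIBLE `(P,l)` only) · [CONE] `hreg` (c312-8 p428563's, verbatim) ·
[ORBIT] `hA` (the per-packet orbit-hull bound, admissible `(P,l)` only; `BridgeHyps`, the q-pin, the provenance link and the Θ-side identification
modulo `hA` are THEOREMS inside: abc-iut-s2-p8 p438078 / `rfl` / abc-iut-w5-d244 p439939 ∘ abc-iut-w4-d013 p437121 / abc-iut-w5-d166 p438889).
Proof: `ThetaPartII.ABC_of_cor312_of_hullRegime` (p428563) over the per-datum theorem `GenuineMShrink.cor312Of_of_SH` at `T.D`, `T.I`,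
`T.isVolumeInputOf`. «`ABC` follows from S_H + these hypotheses as typed, at these data» — no side taken on [IUTchIII] Cor. 3.12; typed ≠ proved;
instantiated ≠ endorsed. [claim: Mochizuki2012, status: disputed] -/
theorem abc_of_SH_v9M
    -- DATA, per datum: the context binders of the summand-route M-level sharp setting (logs FIXED: analytic), the column data, qK (ρ is PINNED to the q-region)
    (M : ∀ (P : NFPoint) (l : ℕ) (T : Cor22.ThetaVolumeDatumAt P l), Type) [∀ P l T, Field (M P l T)] [∀ P l T, NumberField (M P l T)]
    (archPk : ∀ (P : NFPoint) (l : ℕ) (T : Cor22.ThetaVolumeDatumAt P l), letI := T.instFieldF; letI := T.instNumberFieldF; letI := T.instAlgebraF; letI := T.instFieldK;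
        letI := T.instNumberFieldK; letI := T.instAlgebraK; letI := T.instFieldFbar; letI := T.instAlgebraFbar;
        letI := T.instAlgebraKFbar; letI := T.instIsElliptic;
      ∀ (j : (thetaIndexOfInitial T.D).Label) (vQ : (thetaIndexOfInitial T.D).VQ), Set ((logShellsOfInitialDH T.D (analyticLogvVal T.K)).Packet j vQ))
    (archSub : ∀ (P : NFPoint) (l : ℕ) (T : Cor22.ThetaVolumeDatumAt P l), letI := T.instFieldF; letI := T.instNumberFieldF; letI := T.instAlgebraF; letI := T.instFieldK;
        letI := T.instNumberFieldK; letI := T.instAlgebraK; letI := T.instFieldFbar; letI := T.instAlgebraFbar;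
        letI := T.instAlgebraKFbar; letI := T.instIsElliptic;
      ∀ (j : (thetaIndexOfInitial T.D).Label) (v : (thetaIndexOfInitial T.D).V), Set ((logShellsOfInitialDH T.D (analyticLogvVal T.K)).Packet j ((thetaIndexOfInitial T.D).over v)))
    (Ψ : ∀ (P : NFPoint) (l : ℕ) (T : Cor22.ThetaVolumeDatumAt P l), letI := T.instFieldF; letI := T.instNumberFieldF; letI := T.instAlgebraF; letI := T.instFieldK;
        letI := T.instNumberFieldK; letI := T.instAlgebraK; letI := T.instFieldFbar; letI := T.instAlgebraFbar;
        letI := T.instAlgebraKFbar; letI := T.instIsElliptic;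
      ℤ → ∀ v : (thetaIndexOfInitial T.D).V, v ∈ (thetaIndexOfInitial T.D).Vbad → Set ((logShellsOfInitialDH T.D (analyticLogvVal T.K)).StarPacket v))
    (act : ∀ (P : NFPoint) (l : ℕ) (T : Cor22.ThetaVolumeDatumAt P l), letI := T.instFieldF; letI := T.instNumberFieldF; letI := T.instAlgebraF; letI := T.instFieldK;
        letI := T.instNumberFieldK; letI := T.instAlgebraK; letI := T.instFieldFbar; letI := T.instAlgebraFbar;
        letI := T.instAlgebraKFbar; letI := T.instIsElliptic;
      ℤ → ∀ v : (thetaIndexOfInitial T.D).V, v ∈ (thetaIndexOfInitial T.D).Vbad → (logShellsOfInitialDH T.D (analyticLogvVal T.K)).StarPacket v → Module.End ℚ ((logShellsOfInitialDH T.D (analyticLogvVal T.K)).StarPacket v))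
    (Mmod : ∀ (P : NFPoint) (l : ℕ) (T : Cor22.ThetaVolumeDatumAt P l), letI := T.instFieldF; letI := T.instNumberFieldF; letI := T.instAlgebraF; letI := T.instFieldK;
        letI := T.instNumberFieldK; letI := T.instAlgebraK; letI := T.instFieldFbar; letI := T.instAlgebraFbar;
        letI := T.instAlgebraKFbar; letI := T.instIsElliptic;
      ℤ → ∀ j : (thetaIndexOfInitial T.D).LabelStar, Set ((logShellsOfInitialDH T.D (analyticLogvVal T.K)).GlobalPacket j.1))
    (region : ∀ (P : NFPoint) (l : ℕ) (T : Cor22.ThetaVolumeDatumAt P l), letI := T.instFieldF; letI := T.instNumberFieldF; letI := T.instAlgebraF; letI := T.instFieldK;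
        letI := T.instNumberFieldK; letI := T.instAlgebraK; letI := T.instFieldFbar; letI := T.instAlgebraFbar;
        letI := T.instAlgebraKFbar; letI := T.instIsElliptic;
      ℤ → ∀ j : (thetaIndexOfInitial T.D).LabelStar, FinDivisor (M P l T) → ∀ vQ : (thetaIndexOfInitial T.D).VQ, Set ((logShellsOfInitialDH T.D (analyticLogvVal T.K)).Packet j.1 vQ))
    (frobAdm : ∀ (P : NFPoint) (l : ℕ) (T : Cor22.ThetaVolumeDatumAt P l), letI := T.instFieldF; letI := T.instNumberFieldF; letI := T.instAlgebraF; letI := T.instFieldK;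
        letI := T.instNumberFieldK; letI := T.instAlgebraK; letI := T.instFieldFbar; letI := T.instAlgebraFbar;
        letI := T.instAlgebraKFbar; letI := T.instIsElliptic;
      ℤ → ℤ → ∀ (j : (thetaIndexOfInitial T.D).Label) (vQ : (thetaIndexOfInitial T.D).VQ), Set ((logShellsOfInitialDH T.D (analyticLogvVal T.K)).Packet j vQ) → Prop)
    (frobLogvol : ∀ (P : NFPoint) (l : ℕ) (T : Cor22.ThetaVolumeDatumAt P l), letI := T.instFieldF; letI := T.instNumberFieldF; letI := T.instAlgebraF; letI := T.instFieldK;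
        letI := T.instNumberFieldK; letI := T.instAlgebraK; letI := T.instFieldFbar; letI := T.instAlgebraFbar;
        letI := T.instAlgebraKFbar; letI := T.instIsElliptic;
      ℤ → ℤ → ∀ (j : (thetaIndexOfInitial T.D).Label) (vQ : (thetaIndexOfInitial T.D).VQ), Set ((logShellsOfInitialDH T.D (analyticLogvVal T.K)).Packet j vQ) → ℝ)
    (frobΨ : ∀ (P : NFPoint) (l : ℕ) (T : Cor22.ThetaVolumeDatumAt P l), letI := T.instFieldF; letI := T.instNumberFieldF; letI := T.instAlgebraF; letI := T.instFieldK;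
        letI := T.instNumberFieldK; letI := T.instAlgebraK; letI := T.instFieldFbar; letI := T.instAlgebraFbar;
        letI := T.instAlgebraKFbar; letI := T.instIsElliptic;
      ℤ → ℤ → ∀ v : (thetaIndexOfInitial T.D).V, v ∈ (thetaIndexOfInitial T.D).Vbad → Set ((logShellsOfInitialDH T.D (analyticLogvVal T.K)).StarPacket v))
    (frobMmod : ∀ (P : NFPoint) (l : ℕ) (T : Cor22.ThetaVolumeDatumAt P l), letI := T.instFieldF; letI := T.instNumberFieldF; letI := T.instAlgebraF; letI := T.instFieldK;
        letI := T.instNumberFieldK; letI := T.instAlgebraK; letI := T.instFieldFbar; letI := T.instAlgebraFbar;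
        letI := T.instAlgebraKFbar; letI := T.instIsElliptic;
      ℤ → ℤ → ∀ j : (thetaIndexOfInitial T.D).LabelStar, Set ((logShellsOfInitialDH T.D (analyticLogvVal T.K)).GlobalPacket j.1))
    (unitImage : ∀ (P : NFPoint) (l : ℕ) (T : Cor22.ThetaVolumeDatumAt P l), letI := T.instFieldF; letI := T.instNumberFieldF; letI := T.instAlgebraF; letI := T.instFieldK;
        letI := T.instNumberFieldK; letI := T.instAlgebraK; letI := T.instFieldFbar; letI := T.instAlgebraFbar;
        letI := T.instAlgebraKFbar; letI := T.instIsElliptic;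
      ℤ → ℤ → ℕ → ∀ (j : (thetaIndexOfInitial T.D).Label) (vQ : (thetaIndexOfInitial T.D).VQ), Set ((logShellsOfInitialDH T.D (analyticLogvVal T.K)).Packet j vQ))
    (ballImage : ∀ (P : NFPoint) (l : ℕ) (T : Cor22.ThetaVolumeDatumAt P l), letI := T.instFieldF; letI := T.instNumberFieldF; letI := T.instAlgebraF; letI := T.instFieldK;
        letI := T.instNumberFieldK; letI := T.instAlgebraK; letI := T.instFieldFbar; letI := T.instAlgebraFbar;
        letI := T.instAlgebraKFbar; letI := T.instIsElliptic;
      ℤ → ℤ → ∀ (j : (thetaIndexOfInitial T.D).Label) (vQ : (thetaIndexOfInitial T.D).VQ), Set ((logShellsOfInitialDH T.D (analyticLogvVal T.K)).Packet j vQ))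
    (thetaDiv : ∀ (P : NFPoint) (l : ℕ) (T : Cor22.ThetaVolumeDatumAt P l), letI := T.instFieldF; letI := T.instNumberFieldF; letI := T.instAlgebraF; letI := T.instFieldK;
        letI := T.instNumberFieldK; letI := T.instAlgebraK; letI := T.instFieldFbar; letI := T.instAlgebraFbar;
        letI := T.instAlgebraKFbar; letI := T.instIsElliptic;
      ℤ → ℤ → LgpDivisor (M P l T) (thetaIndexOfInitial T.D).lstar)
    (n : ∀ (P : NFPoint) (l : ℕ) (T : Cor22.ThetaVolumeDatumAt P l), ℤ)
    {HT : ∀ (P : NFPoint) (l : ℕ) (T : Cor22.ThetaVolumeDatumAt P l), Type} {LogLink : ∀ (P : NFPoint) (l : ℕ) (T : Cor22.ThetaVolumeDatumAt P l), HT P l T → HT P l T → Type}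
    {IsFull : ∀ (P : NFPoint) (l : ℕ) (T : Cor22.ThetaVolumeDatumAt P l), ∀ {s t : HT P l T}, LogLink P l T s t → Prop}
    (lat : ∀ (P : NFPoint) (l : ℕ) (T : Cor22.ThetaVolumeDatumAt P l), LGPGaussianLogThetaLattice (LogLink P l T) (IsFull P l T))
    {Frd : ∀ (P : NFPoint) (l : ℕ) (T : Cor22.ThetaVolumeDatumAt P l), Type} {IsoF : ∀ (P : NFPoint) (l : ℕ) (T : Cor22.ThetaVolumeDatumAt P l), Frd P l T → Frd P l T → Type} {Ob : ∀ (P : NFPoint) (l : ℕ) (T : Cor22.ThetaVolumeDatumAt P l), Frd P l T → Type}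
    {realify : ∀ (P : NFPoint) (l : ℕ) (T : Cor22.ThetaVolumeDatumAt P l), Frd P l T → Frd P l T} {Strip : ∀ (P : NFPoint) (l : ℕ) (T : Cor22.ThetaVolumeDatumAt P l), Type} {IsoS : ∀ (P : NFPoint) (l : ℕ) (T : Cor22.ThetaVolumeDatumAt P l), Strip P l T → Strip P l T → Type}
    {Mv : ∀ (P : NFPoint) (l : ℕ) (T : Cor22.ThetaVolumeDatumAt P l), letI := T.instFieldF; letI := T.instNumberFieldF; letI := T.instAlgebraF; letI := T.instFieldK;
        letI := T.instNumberFieldK; letI := T.instAlgebraK; letI := T.instFieldFbar; letI := T.instAlgebraFbar;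
        letI := T.instAlgebraKFbar; letI := T.instIsElliptic;
      ∀ v : (thetaIndexOfInitial T.D).V, v ∈ (thetaIndexOfInitial T.D).Vbad → Type}
    [∀ P l T v h, Monoid (Mv P l T v h)]
    (sig : ∀ (P : NFPoint) (l : ℕ) (T : Cor22.ThetaVolumeDatumAt P l), letI := T.instFieldF; letI := T.instNumberFieldF; letI := T.instAlgebraF; letI := T.instFieldK;
        letI := T.instNumberFieldK; letI := T.instAlgebraK; letI := T.instFieldFbar; letI := T.instAlgebraFbar;
        letI := T.instAlgebraKFbar; letI := T.instIsElliptic;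
      GlobalLGPFrobenioidSignature (thetaIndexOfInitial T.D).lstar (thetaIndexOfInitial T.D).V (· ∈ (thetaIndexOfInitial T.D).Vbad) (Frd P l T) (IsoF P l T) (Ob P l T) (realify P l T)
        (Strip P l T) (IsoS P l T) (Mv P l T))
    (split : ∀ (P : NFPoint) (l : ℕ) (T : Cor22.ThetaVolumeDatumAt P l), SplittingMonoids (Mv P l T))
    {ObΔ : ∀ (P : NFPoint) (l : ℕ) (T : Cor22.ThetaVolumeDatumAt P l), Type}
    {N : ∀ (P : NFPoint) (l : ℕ) (T : Cor22.ThetaVolumeDatumAt P l), letI := T.instFieldF; letI := T.instNumberFieldF; letI := T.instAlgebraF; letI := T.instFieldK;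
        letI := T.instNumberFieldK; letI := T.instAlgebraK; letI := T.instFieldFbar; letI := T.instAlgebraFbar;
        letI := T.instAlgebraKFbar; letI := T.instIsElliptic;
      ∀ v : (thetaIndexOfInitial T.D).V, v ∈ (thetaIndexOfInitial T.D).Vbad → Type}
    [∀ P l T v h, Monoid (N P l T v h)] (qData : ∀ (P : NFPoint) (l : ℕ) (T : Cor22.ThetaVolumeDatumAt P l), QPilotData (ObΔ P l T) (N P l T))
    (qK : ∀ (P : NFPoint) (l : ℕ) (T : Cor22.ThetaVolumeDatumAt P l), letI := T.instFieldF; letI := T.instNumberFieldF; letI := T.instAlgebraF; letI := T.instFieldK;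
        letI := T.instNumberFieldK; letI := T.instAlgebraK; letI := T.instFieldFbar; letI := T.instAlgebraFbar;
        letI := T.instAlgebraKFbar; letI := T.instIsElliptic;
      ∀ v : (thetaIndexOfInitial T.D).V, v ∈ (thetaIndexOfInitial T.D).Vbad → Set ((logShellsOfInitialDH T.D (analyticLogvVal T.K)).StarPacket v))
    -- [S_H] the HULL-LEVEL form of the printed clause AT THE PINNED READING (ρ := the setting's own q-region), ADMISSIBLE (P,l) only, AT THESE DATA
    (hSH : ∀ (P : NFPoint), P ∈ UP → ∀ (l : ℕ), l.Prime → 5 ≤ l →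
      Cor22.AdmitsCore P → Cor22.CondP2 P l → Cor22.CondP5 P l → Cor22.CondP6 P l →
      ∀ (T : Cor22.ThetaVolumeDatumAt P l), letI := T.instFieldF; letI := T.instNumberFieldF; letI := T.instAlgebraF; letI := T.instFieldK;
        letI := T.instNumberFieldK; letI := T.instAlgebraK; letI := T.instFieldFbar; letI := T.instAlgebraFbar;
        letI := T.instAlgebraKFbar; letI := T.instIsElliptic;
      Cor312Vol.PilotKummerCompatHull
        (LatticeSituation.ofShells (logShellsOfInitialDH T.D (analyticLogvVal T.K)) (M P l T) (archPk P l T) (archSub P l T)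
          (summandPiecesPrM T.D (logvAnalyticVal_analyticLogvVal (K := T.K))).Adm
          (summandPiecesPrM T.D (logvAnalyticVal_analyticLogvVal (K := T.K))).logvol (Ψ P l T) (act P l T) (Mmod P l T)
          (region P l T) (frobAdm P l T) (frobLogvol P l T) (frobΨ P l T) (frobMmod P l T) (unitImage P l T) (ballImage P l T)
          (thetaDiv P l T))
        (settingPrVolSharpM T.D (logvAnalyticVal_analyticLogvVal (K := T.K)) (tOfIdeleData T.D (ideleDataOf T.D T.isVolumeInputOf))
          (fun u x => tqM T.D (ratChar u) u (natCast_ratChar_mem u) (ideleDataOf T.D T.isVolumeInputOf) x)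
          (M P l T) (archPk P l T) (archSub P l T) (Ψ P l T) (act P l T)
          (Mmod P l T) (region P l T) (n P l T) (lat P l T) (sig P l T) (split P l T) (qData P l T)
          (fun u x => tqM_ne_zero T.D (ratChar u) u (natCast_ratChar_mem u) (ideleDataOf T.D T.isVolumeInputOf) x)
          (GenuineM.finite_ratPlaces_under_S T.D).toFinset
          (fun u x hu => norm_tqM_eq_one_of_not_mem T.D (ratChar u) u (natCast_ratChar_mem u) (ideleDataOf T.D T.isVolumeInputOf) x
            fun hx => hu ((Set.Finite.mem_toFinset _).mpr ⟨x, hx⟩))) 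
        (fun _ => Cor312.Setting.qRegion
        (settingPrVolSharpM T.D (logvAnalyticVal_analyticLogvVal (K := T.K)) (tOfIdeleData T.D (ideleDataOf T.D T.isVolumeInputOf))
          (fun u x => tqM T.D (ratChar u) u (natCast_ratChar_mem u) (ideleDataOf T.D T.isVolumeInputOf) x)
          (M P l T) (archPk P l T) (archSub P l T) (Ψ P l T) (act P l T)
          (Mmod P l T) (region P l T) (n P l T) (lat P l T) (sig P l T) (split P l T) (qData P l T)
          (fun u x => tqM_ne_zero T.D (ratChar u) u (natCast_ratChar_mem u) (ideleDataOf T.D T.isVolumeInputOf) x)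
          (GenuineM.finite_ratPlaces_under_S T.D).toFinset
          (fun u x hu => norm_tqM_eq_one_of_not_mem T.D (ratChar u) u (natCast_ratChar_mem u) (ideleDataOf T.D T.isVolumeInputOf) x
            fun hx => hu ((Set.Finite.mem_toFinset _).mpr ⟨x, hx⟩)))) (qK P l T))
    -- [PIN] none (`rfl` at the pinned ρ) · [PROV] none (theorem) · [BRIDGE] none (theorem) · [READ] none (theorem modulo hA) · [FACT] none · [SIDE] none · [CONE] c312-8 p428563's `hreg`, verbatim
    (hreg : ∀ P : NFPoint, P ∈ UP → ∀ l : ℕ, l.Prime → 5 ≤ l →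
      Cor22.AdmitsCore P → Cor22.CondP2 P l → Cor22.CondP5 P l → Cor22.CondP6 P l →
      ∀ T : Cor22.ThetaVolumeDatumAt P l,
        (letI := T.instFieldF; letI := T.instNumberFieldF; letI := T.instAlgebraF; letI := T.instFieldK
         letI := T.instNumberFieldK; letI := T.instAlgebraK; letI := T.instFieldFbar; letI := T.instAlgebraFbar
         letI := T.instAlgebraKFbar; letI := T.instIsElliptic
         ¬ (∀ p ∈ T.I.supportPrimes, ∀ v w : placesOver (fieldOfModuli T.E) p,
            (Summit.ABC.IUTFork.DHData.ofInput T.I).logQloc p v = (Summit.ABC.IUTFork.DHData.ofInput T.I).logQloc p w)) →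
        T.HullEstimateOf
          (((l : ℝ) + 1) / 4 *
            ((1 + 12 * (Cor22.dmod P : ℝ) / l) * (P.logDiff + Cor22.logCondAvoid P {2, l})
              + 2 * Real.log l + 52
              + 20 / 3 * Real.log (((2 ^ 12 * 3 ^ 3 * 5 * Cor22.dmod P : ℕ) : ℝ) * (l : ℝ))
                * (Nat.primeCounting (2 ^ 12 * 3 ^ 3 * 5 * Cor22.dmod P * l) : ℝ))))
    -- [ORBIT] the per-packet (Ind1)(Ind2)-ORBIT-HULL bound of the local Θ-volume at every finite place, ADMISSIBLE (P,l) only (G1-Θ (U1)-HULL instA/instB/instC target AS TYPED, p438889's `hA`)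
    (hA : ∀ (P : NFPoint), P ∈ UP → ∀ (l : ℕ), l.Prime → 5 ≤ l →
      Cor22.AdmitsCore P → Cor22.CondP2 P l → Cor22.CondP5 P l → Cor22.CondP6 P l →
      ∀ (T : Cor22.ThetaVolumeDatumAt P l), letI := T.instFieldF; letI := T.instNumberFieldF; letI := T.instAlgebraF; letI := T.instFieldK;
        letI := T.instNumberFieldK; letI := T.instAlgebraK; letI := T.instFieldFbar; letI := T.instAlgebraFbar;
        letI := T.instAlgebraKFbar; letI := T.instIsElliptic;
      ∀ (i : Fin (thetaIndexOfInitial T.D).lstar) (u : FinitePlace ℚ),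
        (settingMSharp T.D (logvAnalyticVal_analyticLogvVal (K := T.K))
          (M P l T) (archPk P l T) (archSub P l T) (Ψ P l T) (act P l T)
          (Mmod P l T) (region P l T) (n P l T) (lat P l T) (sig P l T) (split P l T) (qData P l T)
          (tOfIdeleData T.D (ideleDataOf T.D T.isVolumeInputOf))
          (fun u x => tqM T.D (ratChar u) u (natCast_ratChar_mem u) (ideleDataOf T.D T.isVolumeInputOf) x)
          (fun u x => tqM_ne_zero T.D (ratChar u) u (natCast_ratChar_mem u) (ideleDataOf T.D T.isVolumeInputOf) x)
          (GenuineM.finite_ratPlaces_under_S T.D).toFinset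
          (fun u x hu => norm_tqM_eq_one_of_not_mem T.D (ratChar u) u (natCast_ratChar_mem u) (ideleDataOf T.D T.isVolumeInputOf) x
            fun hx => hu ((Set.Finite.mem_toFinset _).mpr ⟨x, hx⟩))).thetaLocal (Setting.labelSucc i) (Val.non u) ≤
          ((orbitSumM T.D (ideleDataOf T.D T.isVolumeInputOf) i u : ℝ) : WithTop ℝ))
    : _root_.ABC := by
  -- [IUTchIII] Cor 3.12 at every ADMISSIBLE genuine Θ-volume datum on the HULL-LEVEL line at the summand-route M-setting, q-region pinned (§1)
  refine ThetaPartII.ABC_of_cor312_of_hullRegime (fun P hP l hl h5 hc h2 h5' h6 T => ?_) hreg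
  letI := T.instFieldF; letI := T.instNumberFieldF; letI := T.instAlgebraF; letI := T.instFieldK
  letI := T.instNumberFieldK; letI := T.instAlgebraK; letI := T.instFieldFbar; letI := T.instAlgebraFbar
  letI := T.instAlgebraKFbar; letI := T.instIsElliptic
  exact GenuineMShrink.cor312Of_of_SH T.D (M P l T) (archPk P l T) (archSub P l T) (Ψ P l T) (act P l T) (Mmod P l T)
    (region P l T) (frobAdm P l T) (frobLogvol P l T) (frobΨ P l T) (frobMmod P l T) (unitImage P l T) (ballImage P l T)
    (thetaDiv P l T) (n P l T) (lat P l T) (sig P l T) (split P l T) (qData P l T) (qK P l T) T.isVolumeInputOf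
    (hSH P hP l hl h5 hc h2 h5' h6 T) (hA P hP l hl h5 hc h2 h5' h6 T)

end Family

end Summit.ABC.IUTFork.Conditional

end
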